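import Summits.HodgeConjecture.HodgeConjecture.Theorems.F0P3cStCharTSShellOrbitalG          -- ★ p849606 (this seat) Stage B: `normalizedOrbitalIntegral_eq_twoCoset`
import Summits.HodgeConjecture.HodgeConjecture.Theorems.F0P3cStCharTSShellOrbitalGF1        -- ★ (this seat) «HF1-SHELL»; brings «OCAN-SHELL», «S-SHELL», the Ψ-producer and ★ p849606 Stage B
import HarnessLib

/-!
# F0 · P3c · line LH6 «StCharTS» — road (D), brick D3-ii «PSI-SHELL-VALUE»: the normalised canonical orbital integral of `𝟙_{K_n b K_n}` along the split torus IS the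
# two-coset step function `κ·(𝟙_{b(K_n∩T)} + 𝟙_{ʷb(K_n∩T)})` — existence, pointwise clause AND value at the identity frame (the G-side (c₄) closed form, unconditional in
# the letters of ★ F1-G)

Cell `pub/hodgecm-mathlib`, crux H413 = `stmt-HodgeConjecture-24833` (lane `--supports … --as helper`); seat LH2-p03 (g3); road (D) owner LH6-p03 (g0) ∕ LH6-p04 (g3),
dealer F0P3b-plan (g23); consumers ★ p849750 `hlevi_of_closed_forms` (`ΦG`, `hOG`) and ★ p849878 `hshell_of_psi` (`Ψ κ hκ hΨpt hΨtwo`).  THEOREMS ONLY, sorry-free, ★-only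
imports.  HONEST LABEL: HC_CM is proved only modulo the 7 printed citations (2 remaining: hLiu418 = stmt-HodgeConjecture-24832, h413 = stmt-HodgeConjecture-24833) until
rung 0 closes; count-neutral.

THE MATHEMATICS ([Rogawski1990, §4.9 (4.9.4) p. 56; §12.7 L. 12.7.3 (proof) p. 195; §12.2 pp. 173–174]).  «OCAN-SHELL» (★ `exists_normalizedOrbitalIntegral_indicator_shell`) gives
`Ψ ∈ C_c^∞(T)` with `Ψ(t) = δ_B^{1/2}(t)·J₃(t,d)⁻¹·O_{⟦e₁t⟧}(𝟙_{K_nbK_n})` pointwise; Stage B (★ p849606 `normalizedOrbitalIntegral_eq_twoCoset`) turns the character integrals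
`hF1` («HF1-SHELL» ★ `hF1_indicator_shell`) into the VALUE `Ψ = (A·c ∕ μ_T(K_n∩T))·(𝟙_{b(K_n∩T)} + 𝟙_{ʷb(K_n∩T)})`, `A = (ν_G∘e₁⁻¹)(K_n)·#R·δ_B^{1/2}(b)`,
`c = μ_T(T ∩ K_v)`.  Hypotheses: the letters of ★ F1-G (`hns, 𝓘, n, b ∈ M` dominant `hbN hbNbar hbexh`, transversal `R`), a Weyl representative `w₀` normalising `K_n`,
`K_n` compact open with `|k_ij − δ_ij|_w ≤ r < 1`, `b = diag(d)` with `|d₀|_w < |d₁|_w < |d₂|_w`, Haar measures `ν_G` on `U(Φ₃)` (canonical family `m_G`) and `μ_T` on `T`.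

## References
* [Rogawski1990] J. D. Rogawski, *Automorphic Representations of Unitary Groups in Three Variables*, Ann. of Math. Stud. 123 (1990), §4.9 (4.9.4) p. 56; §12.7 L. 12.7.3 (proof)
  p. 195; §12.2 pp. 173–174.
* [Casselman1995] W. Casselman, *Introduction to the theory of admissible representations of p-adic reductive groups* (1995 notes), Lemma 7.1.1 (a) p. 67.
-/

set_option autoImplicit false
set_option linter.dupNamespace false

noncomputable section

open NumberField IsDedekindDomain MeasureTheory Topology Filter Set Subgroup
open scoped Matrix MatrixGroups NNReal Pointwise
open Literature.MeasureTheory.Group Literature.NumberTheory Literature.NumberTheory.Automorphic Literature.NumberTheory.Automorphic.UnitaryGroup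
open Literature.NumberTheory.Rogawski1990

namespace Summit.HodgeConjecture.HodgeConjecture.Cruxes.H413.F0P3cStCharTSShellOrbitalG

variable (L : Type) [Field L] [NumberField L] [IsCMField L]

open scoped Classical in
set_option maxHeartbeats 3200000 in
set_option synthInstance.maxHeartbeats 400000 in
/-- **«PSI-SHELL-VALUE» — THE G-SIDE CLOSED FORM OF (c₄) FOR THE SHELL INDICATOR, at the identity frame.**  There is `Ψ : T → ℂ`, locally constant and compactly supported, with
(i) the Φ-clause of ★ (4.9.4) pointwise at every `t` and every diagonal writing (`Ψ(t) = δ_B^{1/2}(t)·J₃(t,d)⁻¹·O_{⟦e₁ t⟧}(𝟙_{K_nbK_n})`), and (ii) the VALUE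
`Ψ = (A·c ∕ μ_T(K_n ∩ T)) · (𝟙_{b(K_n∩T)} + 1·𝟙_{ʷb(K_n∩T)})`. [cite: Rogawski1990, §4.9 (4.9.4) p. 56; §12.7 L. 12.7.3 (proof) p. 195] [cite: Casselman1995, Lemma 7.1.1 (a) p. 67] -/
theorem exists_normalizedOrbitalIntegral_indicator_shell_eq_twoCoset
    {v : HeightOneSpectrum (𝓞 ↥(maximalRealSubfield L))} (hns : ∀ w : PlacesOver L v, IsCMField.complexConj L • w.1 = w.1)
    (w : PlacesOver L v) (hw : IsCMField.complexConj L • w.1 = w.1)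
    [MeasurableSpace ((cmDatum L 3 (qsForm L)).Local v)] [BorelSpace ((cmDatum L 3 (qsForm L)).Local v)]
    [∀ γ : ((cmDatum L 3 (qsForm L)).Local v), MeasurableSpace (((cmDatum L 3 (qsForm L)).Local v) ⧸ Subgroup.centralizer ({γ} : Set ((cmDatum L 3 (qsForm L)).Local v)))]
    [∀ γ : ((cmDatum L 3 (qsForm L)).Local v), BorelSpace (((cmDatum L 3 (qsForm L)).Local v) ⧸ Subgroup.centralizer ({γ} : Set ((cmDatum L 3 (qsForm L)).Local v)))]
    (νG : Measure ((cmDatum L 3 (qsForm L)).Local v)) [νG.IsHaarMeasure] [νG.IsMulRightInvariant]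
    {mG : OrbitalMeasureFamily ((cmDatum L 3 (qsForm L)).Local v)}
    (hmG : mG.IsCanonical (fun γ => IsRegularElt (γ.val : GL (Fin 3) (LocalRing L v))) νG)
    [MeasurableSpace ↥(unitaryGroupOfForm (conjLocal L (IsCMField.complexConj L) v) (cmLocalForm L 3 v))] [BorelSpace ↥(unitaryGroupOfForm (conjLocal L (IsCMField.complexConj L) v) (cmLocalForm L 3 v))]
    (μT : Measure ↥(cmBorelTriple L 3 v).M) [μT.IsHaarMeasure]
    (𝓘 : (cmBorelTriple L 3 v).IwahoriDatum) (n : ℕ)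
    (hKo : IsOpen ((𝓘.K n) : Set ↥(unitaryGroupOfForm (conjLocal L (IsCMField.complexConj L) v) (cmLocalForm L 3 v)))) (hKc : IsCompact ((𝓘.K n) : Set ↥(unitaryGroupOfForm (conjLocal L (IsCMField.complexConj L) v) (cmLocalForm L 3 v)))) {r : WithZero (Multiplicative ℤ)} (hr : r < 1)
    (hKr : ∀ k ∈ (𝓘.K n), ∀ i j : Fin 3, Valued.v ((((k : GL (Fin 3) (LocalRing L v)).val i j - (1 : Matrix (Fin 3) (Fin 3) (LocalRing L v)) i j) : LocalRing L v) w) ≤ r)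
    (w₀ : ↥(unitaryGroupOfForm (conjLocal L (IsCMField.complexConj L) v) (cmLocalForm L 3 v))) (hw₀ : Units.val (w₀ : GL (Fin 3) (LocalRing L v)) = cmLocalForm L 3 v) (hKw : ∀ κ ∈ 𝓘.K n, w₀ * κ * w₀⁻¹ ∈ 𝓘.K n)
    {b : ↥(unitaryGroupOfForm (conjLocal L (IsCMField.complexConj L) v) (cmLocalForm L 3 v))} (hbM : b ∈ (cmBorelTriple L 3 v).M)
    (hbN : ∀ x ∈ 𝓘.K n ⊓ (cmBorelTriple L 3 v).N, b * x * b⁻¹ ∈ 𝓘.K n)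
    (hbNbar : ∀ x ∈ 𝓘.K n ⊓ 𝓘.Nbar, b⁻¹ * x * b ∈ 𝓘.K n ⊓ 𝓘.Nbar)
    (hbexh : ∀ x ∈ (cmBorelTriple L 3 v).N, ∃ m : ℕ, ∀ m', m ≤ m' → b ^ m' * x * (b ^ m')⁻¹ ∈ 𝓘.K n)
    {R : Finset ↥(unitaryGroupOfForm (conjLocal L (IsCMField.complexConj L) v) (cmLocalForm L 3 v))}
    (hR : IsLeftTransversal (𝓘.K n) (𝓘.K n ⊓ ConjAct.toConjAct b • 𝓘.K n) R)
    {d : Fin 3 → (LocalRing L v)ˣ} (hd : glDiagonal 3 (LocalRing L v) d = (b : GL (Fin 3) (LocalRing L v)))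
    (h01 : Valued.v ((((d 0 : (LocalRing L v)ˣ) : LocalRing L v) : LocalRing L v) w) < Valued.v ((((d 1 : (LocalRing L v)ˣ) : LocalRing L v) : LocalRing L v) w)) (h12 : Valued.v ((((d 1 : (LocalRing L v)ˣ) : LocalRing L v) : LocalRing L v) w) < Valued.v ((((d 2 : (LocalRing L v)ˣ) : LocalRing L v) : LocalRing L v) w)) :
    haveI := locallyCompactSpace_cmBorelU L 3 v
    ∃ Ψ : ↥(cmBorelTriple L 3 v).M → ℂ, IsLocallyConstant Ψ ∧ HasCompactSupport Ψ ∧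
      (∀ (t : ↥(cmBorelTriple L 3 v).M) (d' : Fin 3 → (LocalRing L v)ˣ)
      (hd' : glDiagonal 3 (LocalRing L v) d' = ((t : ↥(unitaryGroupOfForm (conjLocal L (IsCMField.complexConj L) v) (cmLocalForm L 3 v))) : GL (Fin 3) (LocalRing L v)))
      (ha' : IsUnit ((((d' 0)⁻¹ * d' 1 : (LocalRing L v)ˣ) : LocalRing L v) - 1))
      (hb' : IsUnit ((((d' 0)⁻¹ * d' 2 : (LocalRing L v)ˣ) : LocalRing L v) - 1)),
      Ψ t =
          ((rootDeltaChar (cmBorelTriple L 3 v).P ⟨(t : ↥(unitaryGroupOfForm (conjLocal L (IsCMField.complexConj L) v) (cmLocalForm L 3 v))), (cmBorelTriple L 3 v).M_le t.2⟩ : ℂˣ) : ℂ) *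
        (((letI : MeasurableSpace (LocalRing L v) := borel _; haveI : BorelSpace (LocalRing L v) := ⟨rfl⟩
          haveI : SecondCountableTopology (LocalRing L v) := secondCountableTopology_localRing (E := L) v
          ((distribHaarChar (LocalRing L v) ha'.unit)⁻¹ *
            (HeisRing.skewModulus (conjLocal L (IsCMField.complexConj L) v) (continuous_conjLocal L (IsCMField.complexConj L) v) hb'.unit
              (HeisRing.map_unit_torusCentralScalar_sub_one (conjLocal L (IsCMField.complexConj L) v) (cmLocalForm_eq_over L 3 v) t hd' hb'))⁻¹ : ℝ≥0)) : ℝ) : ℂ)⁻¹ *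
        classOrbitalIntegral mG ((DoubleCoset.doubleCoset b ((𝓘.K n) : Set ↥(unitaryGroupOfForm (conjLocal L (IsCMField.complexConj L) v) (cmLocalForm L 3 v))) ((𝓘.K n) : Set ↥(unitaryGroupOfForm (conjLocal L (IsCMField.complexConj L) v) (cmLocalForm L 3 v)))).indicator fun _ => (1 : ℂ)) (ConjClasses.mk ((cmDatumLocalCongr L v (1 : GL (Fin 3) (LocalRing L v)) isUnit_one (F0P3cStCharTSDeltaAtLevi.formCongr_one_qsForm L v)) (t : ↥(unitaryGroupOfForm (conjLocal L (IsCMField.complexConj L) v) (cmLocalForm L 3 v)))))) ∧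
      Ψ = fun t => ((((((νG.map (cmDatumLocalCongr L v (1 : GL (Fin 3) (LocalRing L v)) isUnit_one (F0P3cStCharTSDeltaAtLevi.formCongr_one_qsForm L v)).symm : Measure ↥(unitaryGroupOfForm (conjLocal L (IsCMField.complexConj L) v) (cmLocalForm L 3 v))))).real ((𝓘.K n) : Set ↥(unitaryGroupOfForm (conjLocal L (IsCMField.complexConj L) v) (cmLocalForm L 3 v))) : ℂ) * (R.card : ℂ) * ((rootDeltaChar (cmBorelTriple L 3 v).P (Subgroup.inclusion (cmBorelTriple L 3 v).M_le (⟨b, hbM⟩ : ↥(cmBorelTriple L 3 v).M)) : ℂˣ) : ℂ)) * ((μT.real {t : ↥(cmBorelTriple L 3 v).M | (t : ↥(unitaryGroupOfForm (conjLocal L (IsCMField.complexConj L) v) (cmLocalForm L 3 v))) ∈ cmLocalIntegralLevel L 3 (Matrix.of fun i j : Fin 3 => if i.val + j.val + 1 = 3 then (1 : L) else 0) v} : ℝ) : ℂ)) / ((μT.real ((((𝓘.K n)).comap (cmBorelTriple L 3 v).M.subtype) : Set ↥(cmBorelTriple L 3 v).M) : ℝ) : ℂ) *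
        ({t : ↥(cmBorelTriple L 3 v).M | ((⟨b, hbM⟩ : ↥(cmBorelTriple L 3 v).M))⁻¹ * t ∈ ((((𝓘.K n)).comap (cmBorelTriple L 3 v).M.subtype) : Set ↥(cmBorelTriple L 3 v).M)}.indicator (fun _ => (1 : ℂ)) t +
          1 * {t : ↥(cmBorelTriple L 3 v).M | ((⟨w₀ * b * w₀⁻¹, weylConj_mem_cmTorus L v w₀ hw₀ (⟨b, hbM⟩ : ↥(cmBorelTriple L 3 v).M)⟩ : ↥(cmBorelTriple L 3 v).M))⁻¹ * t ∈ ((((𝓘.K n)).comap (cmBorelTriple L 3 v).M.subtype) : Set ↥(cmBorelTriple L 3 v).M)}.indicator (fun _ => (1 : ℂ)) t) := by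
  haveI := locallyCompactSpace_cmBorelU L 3 v
  obtain ⟨Ψ, hlc, hK, hcl⟩ := exists_normalizedOrbitalIntegral_indicator_shell L w hw νG hmG (𝓘.K n) hKo hKc hr hKr hbM hd h01 h12
  refine ⟨Ψ, hlc, hK, hcl, ?_⟩
  -- the shell indicator is `C_c^∞`; `K_n ∩ T` is compact open in `T`
  have hDo : IsOpen (DoubleCoset.doubleCoset b ((𝓘.K n) : Set ↥(unitaryGroupOfForm (conjLocal L (IsCMField.complexConj L) v) (cmLocalForm L 3 v))) ((𝓘.K n) : Set ↥(unitaryGroupOfForm (conjLocal L (IsCMField.complexConj L) v) (cmLocalForm L 3 v)))) := hKo.mul_left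
  have hDc : IsCompact (DoubleCoset.doubleCoset b ((𝓘.K n) : Set ↥(unitaryGroupOfForm (conjLocal L (IsCMField.complexConj L) v) (cmLocalForm L 3 v))) ((𝓘.K n) : Set ↥(unitaryGroupOfForm (conjLocal L (IsCMField.complexConj L) v) (cmLocalForm L 3 v)))) := (hKc.mul isCompact_singleton).mul hKc
  have hf : IsLocSmooth (X := ((cmDatum L 3 (qsForm L)).Local v)) ((DoubleCoset.doubleCoset b ((𝓘.K n) : Set ↥(unitaryGroupOfForm (conjLocal L (IsCMField.complexConj L) v) (cmLocalForm L 3 v))) ((𝓘.K n) : Set ↥(unitaryGroupOfForm (conjLocal L (IsCMField.complexConj L) v) (cmLocalForm L 3 v)))).indicator fun _ => (1 : ℂ)) := isLocSmooth_indicator hDo hDc.isClosed hDc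
  have hCo : IsOpen ((((𝓘.K n)).comap (cmBorelTriple L 3 v).M.subtype) : Set ↥(cmBorelTriple L 3 v).M) := hKo.preimage continuous_subtype_val
  have hCc : IsCompact ((((𝓘.K n)).comap (cmBorelTriple L 3 v).M.subtype) : Set ↥(cmBorelTriple L 3 v).M) := (isClosed_cmBorelTriple_M L v).isClosedEmbedding_subtypeVal.isCompact_preimage hKc
  exact normalizedOrbitalIntegral_eq_twoCoset L (qsForm L) (qsForm_map_transpose L) (isUnit_det_qsForm L) w hw
    (1 : GL (Fin 3) (LocalRing L v)) isUnit_one (F0P3cStCharTSDeltaAtLevi.formCongr_one_qsForm L v) νG hmG μT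
    ((DoubleCoset.doubleCoset b ((𝓘.K n) : Set ↥(unitaryGroupOfForm (conjLocal L (IsCMField.complexConj L) v) (cmLocalForm L 3 v))) ((𝓘.K n) : Set ↥(unitaryGroupOfForm (conjLocal L (IsCMField.complexConj L) v) (cmLocalForm L 3 v)))).indicator fun _ => (1 : ℂ)) hf.1 hf.2 (((𝓘.K n)).comap (cmBorelTriple L 3 v).M.subtype) hCo hCc (⟨b, hbM⟩ : ↥(cmBorelTriple L 3 v).M) (⟨w₀ * b * w₀⁻¹, weylConj_mem_cmTorus L v w₀ hw₀ (⟨b, hbM⟩ : ↥(cmBorelTriple L 3 v).M)⟩ : ↥(cmBorelTriple L 3 v).M) (((((νG.map (cmDatumLocalCongr L v (1 : GL (Fin 3) (LocalRing L v)) isUnit_one (F0P3cStCharTSDeltaAtLevi.formCongr_one_qsForm L v)).symm : Measure ↥(unitaryGroupOfForm (conjLocal L (IsCMField.complexConj L) v) (cmLocalForm L 3 v))))).real ((𝓘.K n) : Set ↥(unitaryGroupOfForm (conjLocal L (IsCMField.complexConj L) v) (cmLocalForm L 3 v))) : ℂ) * (R.card : ℂ) * ((rootDeltaChar (cmBorelTriple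 L 3 v).P (Subgroup.inclusion (cmBorelTriple L 3 v).M_le (⟨b, hbM⟩ : ↥(cmBorelTriple L 3 v).M)) : ℂˣ) : ℂ)) 1
    (hF1_indicator_shell L hns νG 𝓘 n w₀ hw₀ hKw hbM hbN hbNbar hbexh hR) Ψ hlc hK
    (Filter.Eventually.of_forall fun t d' hd' ha' hb' => hcl t d' hd' ha' hb')

end Summit.HodgeConjecture.HodgeConjecture.Cruxes.H413.F0P3cStCharTSShellOrbitalG

end
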